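import Mathlib
import Summits.Ventures.PercRepro2.SwOutJunctionH1GTypedShadow

/-!
# The (H1) single junction on the general doubly typed side, III: the two orbit lemmas (blind
cell PercRepro2, night-4 g33, 2026-08-28; proofs/NIGHT4-G33.md §3)

g14's orbit lemmas (SwOutJunctionH1Kinds §Orbits) on g7's general doubly typed side: an escaping
side point of the coarse orbit of a core-free core-kind point is of the shadow kind
(`shadowKind_of_mem_orbit_coreKind_g`), so is one in the orbit of a shadow-kind point
(`shadowKind_of_mem_orbit_shadowKind_g`), and a side point of the orbit of an escaping point of
the plain kind is escaping of the plain kind (`mem_orbit_plain_g`).  The proofs are g14's with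
the side lemmas of SwOutJunctionH1GTypedSides / SwOutJunctionH1GTypedShadow in place of the
principal ones.
-/

namespace Summit.Ventures.PercRepro2

namespace LocRows

open Hull

variable {V : Type*} {E : Type*} [Fintype E] [DecidableEq E]

open scoped Classical

variable {ends : E → Sym2 V} {U : Set V} {ξ : Config E} {l h u : V}
  {𝓤 𝓓 𝓓'' : Set (Set V)} {X : Set V} {𝓤' : Set (Set V)} {F : V → Prop}

section Orbits

variable (hl : l ∉ U) (hhu : h ≠ u) (hloop_h : ∀ e, ends e ≠ s(h, h))
  (hloop_u : ∀ e, ends e ≠ s(u, u)) (hnadj : ∀ e, ends e ≠ s(h, u))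
  (hF : ∀ x, F x → ∀ S ∈ 𝓤, x ∈ S)
  (hout : ∀ x ∈ U, x ≠ h → x ≠ u →
    F x ∨ x ∈ X ∨ (∃ e y, ends e = s(x, y) ∧ y ∉ U) ∨ (∀ e, x ∉ ends e))
  (hhX : h ∉ X) (huX : u ∉ X) (hX : ∀ x ∈ X, x ∈ U → ∀ e, x ∈ ends e → ends e = s(x, x))
  (hH1 : H1 ends U h u)
include hl hhu hloop_h hloop_u hnadj hF hout hhX huX hX hH1

/-- **The orbit through a sealed point**: an escaping side point of the coarse orbit of a core-free
core-kind side point is of the shadow kind. -/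
theorem shadowKind_of_mem_orbit_coreKind_g {ζ' : Config E} (hζ' : ζ' ∈ gOutSide ends l h 𝓤 𝓓 𝓓'' X 𝓤' U ξ)
    (hk : CoreKind ends U h u ζ') (hc' : CoreFree ends ζ' h) {ζ : Config E}
    (hζ : ζ ∈ orbit ends (allRed ends ζ' h) h) (hQ : ζ ∈ gTypedQ ends l h 𝓤 𝓓 𝓓'' X 𝓤')
    (hesc : ¬ hull ends ζ u ⊆ U) : ShadowKind ends U ξ h u ζ := by
  have hb : CoreBase ends (coreBaseOf ends ζ' h u) h u (extHull ends ζ' h u)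
      (armsFun (armsC ends h u ζ')) (pureFun ends h (armsC ends h u ζ')) :=
    coreBase_of_coreKind_g hl hhu hloop_h hloop_u hnadj hF hout hX hH1 hζ' hk
  have hHU := extHull_subset_of_coreKind_g hζ' hk
  have hrep : coreReal ends (armsFun (armsC ends h u ζ')) (coreBaseOf ends ζ' h u)
      (omegaOf ends h u ζ') = ζ' := coreReal_coreBaseOf_g hl hhu hF hout hX hζ' hk
  have hone := hb.oneSided_of_coreFree (ω := omegaOf ends h u ζ') (by rw [hrep]; exact hc')
    (by rw [hrep]; exact hk.1)
  obtain ⟨ω₀, huR, huB, hω⟩ := exists_normalised (A := armsFun (armsC ends h u ζ'))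
    (pure := pureFun ends h (armsC ends h u ζ')) hone
  have hconn : ArmsConnected (armsFun (armsC ends h u ζ')) ends := armsConnected_armsC ζ'
  rw [← hrep] at hζ
  rcases hb.mem_orbit_coreReal_oneSided huR huB hconn hω hζ with ⟨ω'', hζeq⟩ | ⟨ω₁, hζeq⟩
  · -- `ζ` is a shadow point of the normalised point
    have hagree : ∀ i, uAdjC ends u (armsFun (armsC ends h u ζ')) i →
        ω₀ i = omegaSR (armsC ends h u ζ') (redSetOf ω₀ ends u) i :=
      fun i hi => omegaSR_redSetOf ω₀ i hi
    have hb' : CoreBase ends (coreBaseOf ends ζ' h u) h u (extHull ends (coreBaseOf ends ζ' h u) h u)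
        (armsFun (armsC ends h u ζ')) (pureFun ends h (armsC ends h u ζ')) := by
      rw [hb.extHull_base]; exact hb
    by_cases hZ : ∃ P : armsC ends h u ζ', uAdjC ends u (armsFun (armsC ends h u ζ')) P ∧ ω₀ P = false
    · have hζblk : ζ ∈ shadowBlock ends u (coreBaseOf ends ζ' h u) (armsC ends h u ζ')
          (redSetOf ω₀ ends u) := by
        rw [mem_shadowBlock_iff]
        refine ⟨ω'', ?_⟩
        rw [hζeq, sB_congr hagree, sZ_congr hagree, shadowOf_congr hagree]
      have hd : ShadowData ends U ξ h u (coreBaseOf ends ζ' h u) (armsC ends h u ζ')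
          (redSetOf ω₀ ends u) :=
        { hS := (armsC_eq_of_extHull_eq (hb.extHull_base)).symm
          hb := hb'
          hHU := by rw [hb.extHull_base]; exact hHU
          hbcl := coreBaseOf_mem_outClass (mem_gOutSide.1 hζ').2 hk hb
          huR := (uRed_congr hagree).1 huR
          huB := fun h' => huB ((uRed_congr (flipAll_congr hagree)).2 h')
          hZ := by
            obtain ⟨P, hP, hωP⟩ := hZ
            exact ⟨P, hP, by rw [← hagree P hP]; exact hωP⟩
          hR := redSetOf_canon ω₀ }
      exact (shadowKind_of_mem_shadowBlock_g hl hF hout hhX huX hX hd hζblk hQ).2.2.2.1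
    · -- no dropped arm: `ζ` is a core point, not escaping
      exfalso
      have hZ' : ∀ i, uAdjC ends u (armsFun (armsC ends h u ζ')) i → ω₀ i = true := by
        intro i hi
        by_contra hne
        exact hZ ⟨i, hi, by simpa using hne⟩
      obtain ⟨ω₁, hω₁⟩ := hb.shadowReal_eq_coreReal_of_no_drop hZ' ω''
      apply hesc
      rw [hζeq, hω₁]
      exact (hb.hull_u_coreReal_subset ω₁).trans hHU
  · exfalso
    apply hesc
    rw [hζeq]
    exact (hb.hull_u_coreReal_subset ω₁).trans hHU

omit hhu hloop_h hloop_u hnadj hH1 in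
/-- **The orbit through a shadow point**: an escaping side point of the coarse orbit of a
shadow-kind point is of the shadow kind. -/
theorem shadowKind_of_mem_orbit_shadowKind_g {ζ' : Config E} (hsk : ShadowKind ends U ξ h u ζ')
    {ζ : Config E} (hζ : ζ ∈ orbit ends (allRed ends ζ' h) h)
    (hQ : ζ ∈ gTypedQ ends l h 𝓤 𝓓 𝓓'' X 𝓤') (hesc : ¬ hull ends ζ u ⊆ U) :
    ShadowKind ends U ξ h u ζ := by
  obtain ⟨hd, hblk⟩ := hsk
  have hconn : ArmsConnected (armsFun (armsOf ends h u ζ')) ends := by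
    rw [hd.hS]; exact armsConnected_armsC _
  obtain ⟨ω'', hζ'eq⟩ := (mem_shadowBlock_iff).1 hblk
  rw [← hζ'eq] at hζ
  rcases hd.hb.mem_orbit_shadowReal hd.huR hd.huB hconn ω'' hζ with ⟨ω''', hζeq⟩ | ⟨ω₁, hζeq⟩
  · have hζblk : ζ ∈ shadowBlock ends u (baseOf ends h u ζ') (armsOf ends h u ζ')
        (redOf ends h u ζ') := (mem_shadowBlock_iff).2 ⟨ω''', hζeq.symm⟩
    exact (shadowKind_of_mem_shadowBlock_g hl hF hout hhX huX hX hd hζblk hQ).2.2.2.1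
  · exfalso
    apply hesc
    rw [hζeq]
    exact (hd.hb.hull_u_coreReal_subset ω₁).trans hd.hHU

/-- **A side point of the orbit of an escaping point of the plain kind is escaping of the plain
kind** (and lies in the class). -/
theorem mem_orbit_plain_g {ζ : Config E} (hζ : ζ ∈ gOutSide ends l h 𝓤 𝓓 𝓓'' X 𝓤' U ξ)
    (hu : u ∈ hull ends ζ h) (hesc : ¬ hull ends ζ u ⊆ U) (hns : ¬ ShadowKind ends U ξ h u ζ)
    {ζ' : Config E} (hζ' : ζ' ∈ orbit ends (allRed ends ζ h) h)
    (hQ : ζ' ∈ gTypedQ ends l h 𝓤 𝓓 𝓓'' X 𝓤') :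
    ζ' ∈ gOutSide ends l h 𝓤 𝓓 𝓓'' X 𝓤' U ξ ∧ u ∈ hull ends ζ' h ∧ ¬ hull ends ζ' u ⊆ U ∧
      ¬ ShadowKind ends U ξ h u ζ' := by
  have hc : CoreFree ends ζ h := coreFree_of_escaping_g hF hout hζ hesc
  have hc₀ : CoreFree ends (allRed ends ζ h) h := coreFree_allRed hc
  have hcl₀ : allRed ends ζ h ∈ outClass ends U h ξ :=
    allRed_mem_outClass (mem_gOutSide.1 hζ).2 hc
  have hmem := hζ'
  simp only [orbit, Finset.mem_image, Finset.mem_univ, true_and] at hmem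
  obtain ⟨ω', rfl⟩ := hmem
  have hζ'cl : orbitReal ends (allRed ends ζ h) h ω' ∈ gOutSide ends l h 𝓤 𝓓 𝓓'' X 𝓤' U ξ :=
    mem_gOutSide.2 ⟨hQ, orbitReal_mem_outClass hc₀ hcl₀ ω'⟩
  have hu' : u ∈ hull ends (orbitReal ends (allRed ends ζ h) h ω') h := by
    rw [hull_orbitReal hc₀, hull_allRed hc]; exact hu
  have hc' : CoreFree ends (orbitReal ends (allRed ends ζ h) h ω') h := coreFree_orbitReal hc₀ ω'
  have hζorb : ζ ∈ orbit ends (allRed ends (orbitReal ends (allRed ends ζ h) h ω') h) h := by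
    rw [allRed_orbitReal hc₀, allRed_idem hc]
    obtain ⟨ω, hω⟩ := exists_orbitReal_eq (ζ₀ := allRed ends ζ h) hc rfl
    simp only [orbit, Finset.mem_image, Finset.mem_univ, true_and]
    exact ⟨ω, hω⟩
  have hQζ : ζ ∈ gTypedQ ends l h 𝓤 𝓓 𝓓'' X 𝓤' := (mem_gOutSide.1 hζ).1
  refine ⟨hζ'cl, hu', fun hsub => ?_, fun hsk => ?_⟩
  · exact hns (shadowKind_of_mem_orbit_coreKind_g hl hhu hloop_h hloop_u hnadj hF hout hhX huX hX hH1
      hζ'cl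
      ⟨hu', hsub⟩ hc' hζorb hQζ hesc)
  · exact hns (shadowKind_of_mem_orbit_shadowKind_g hl hF hout hhX huX hX hsk hζorb hQζ hesc)

end Orbits

end LocRows

end Summit.Ventures.PercRepro2
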